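import Summits.KontsevichZagierPeriods.KontsevichZagierPeriods.Theorems.RootDecompRelativeModAbsoluteCylLogSplitP47

/-! # `RootDecompRelativeModAbsoluteCylLogSplitP48` — part 23/27 of the mechanical ≤400-line split of `RungClosure.lean` (sha256 f909f334226f0fb5…)
Source: decomp-kz lens-3 g12 `RungClosure.lean` v9 (HOME/decomp-kz-lens-3/g12/, sha256 f909f334…; critic g4-52/g4-57/g5 CLEARED, «lander: split v9 --supports 30572»): BLOCK I (57 g11 monolith decls missing from P01–P25), BLOCK II/III (WildCertAssembly parts 1–6, 8–10: `Leaf.cellLocalWildCert`, `Leaf.cylKernelZeroLog_of_trees`), Parts 12–13 (`Leaf.regKernelPairDegOne_iff_circlePos_of_trees`), BLOCK G13 (Möbius engine, test §C decided).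
Split by census-1 g9 `gen/splitlean.py`: scopes re-opened with their `open`/`variable`/`set_option` context; mathematics and declaration order unchanged. -/

noncomputable section
open Set MeasureTheory Filter Topology
open scoped BigOperators
open Literature.NumberTheory.Transcendental Literature.ModelTheory.ExponentialFields
namespace Summit.KontsevichZagierPeriods.RootDecompRelativeModAbsolute.Rung30571.RegularisedLogLayer.CylLog.Leaf

/-- The three elements of `Fin 3` (file-local copy; the public twin lives in an unrelated Literature module). [bookkeeping] -/
private theorem fin3_cases' (t : Fin 3) : t = 0 ∨ t = 1 ∨ t = 2 := by
  fin_cases t <;> simp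

/-- **Sign cells: `CylKernelZeroMixedSigned ⟹ CylKernelZeroMixed` (PROVED)** — restrict the cylinder to the open
sign cells of the `κᵢ` (full measure, landed §3x/§3v) and close each cell. -/
theorem cylKernelZeroMixed_of_signed (hS : CylKernelZeroMixedSigned) : CylKernelZeroMixed := by
  intro P V a₀ q c κ M e hP ha₀ ha₀i hc hκ he h2 hκ1 hint hL1 hdom hV hae
  -- (1) an open full-measure sub-base on which the `κᵢ` are continuous, (2) its sign cells
  obtain ⟨G, hGP, hGo, hG, hκ_sm, hnG⟩ := exists_open_smooth_subset hP κ hκ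
  have hκc : ∀ i, ContinuousOn (κ i) G := fun i => (hκ_sm i).continuousOn
  obtain ⟨N, D, σ, hD, hDd, hDn, hσ0, hσ1, hσ2⟩ :=
    exists_sign_cells hGo hG κ (fun i => (hκ i).mono hGP hG) hκc
  have hDP : ∀ l, D l ⊆ P := fun l => (hD l).2.2.trans hGP
  have hnull : volume (P \ ⋃ l, D l) = 0 := by
    have hsub : P \ ⋃ l, D l ⊆ (P \ G) ∪ (G \ ⋃ l, D l) := by
      intro x hx
      by_cases h₁ : x ∈ G
      · exact Or.inr ⟨h₁, hx.2⟩
      · exact Or.inl ⟨hx.1, h₁⟩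
    exact measure_mono_null hsub (measure_union_null hnG hDn)
  -- (3) restrict the cylinder to the cells
  have hcyl_sa : ∀ S : Set (Fin 1 → ℝ), IsSemialgebraic ℚ S →
      IsSemialgebraic ℚ {z : Fin (1 + 1) → ℝ | (Fin.init z : Fin 1 → ℝ) ∈ S ∧ z (Fin.last 1) ∈ Set.Ioo 0 1} :=
    fun S hS => RTerm.isSemialgebraic_cyl hS
  obtain ⟨Vc, hVcd, hVci, hrel⟩ := exists_restrict_parts_ae (hcyl_sa P hP)
    (fun l => {z : Fin (1 + 1) → ℝ | (Fin.init z : Fin 1 → ℝ) ∈ D l ∧ z (Fin.last 1) ∈ Set.Ioo 0 1})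
    (fun l => hcyl_sa _ (hD l).1) (fun l z hz => ⟨hDP l hz.1, hz.2⟩)
    (fun l l' hne => Set.disjoint_left.mpr fun z hz hz' => Set.disjoint_left.mp (hDd hne) hz.1 hz'.1)
    (by
      refine measure_mono_null (fun z hz => ?_) (KZ.volume_setOf_init_mem_eq_zero hnull)
      refine ⟨hz.1.1, fun hU => hz.2 ?_⟩
      obtain ⟨l, hl⟩ := mem_iUnion.mp hU
      exact mem_iUnion.mpr ⟨l, hl, hz.1.2⟩)
    V hdom
  -- (4) each cell closes by `CylKernelZeroMixedSigned`
  have hVl : ∀ l, KZ.of (Vc l) ∈ KZ.relations := by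
    intro l
    obtain ⟨hDsa, hDo, -⟩ := hD l
    refine hS (D l) (Vc l) a₀ q c κ M e hDo hDsa (ha₀.mono (hDP l) hDsa) (ha₀i.mono_set (hDP l))
      (fun i => (hc i).mono (hDP l) hDsa) (fun i => (hκ i).mono (hDP l) hDsa) he h2
      (fun i x hx => hκ1 i x (hDP l hx)) ?_ (fun i => (hint i).mono_set fun z hz => ⟨hDP l hz.1, hz.2⟩)
      (fun i => (hL1 i).mono_set (hDP l)) (hVcd l) ?_ (hae.mono fun x hx hxD => hx (hDP l hxD))
    · intro i _
      rcases fin3_cases' (σ l i) with h | h | h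
      · exact Or.inl (hσ0 l i h)
      · exact Or.inr fun x hx => (hσ1 l i h x hx).le
      · exact Or.inr fun x hx => (hσ2 l i h x hx).le
    · intro z hz
      rw [hVci l]
      have hz' : z ∈ {z : Fin (1 + 1) → ℝ | (Fin.init z : Fin 1 → ℝ) ∈ D l ∧ z (Fin.last 1) ∈ Set.Ioo 0 1} :=
        hVcd l ▸ hz
      exact hV (by rw [hdom]; exact ⟨hDP l hz'.1, hz'.2⟩)
  have eV : KZ.of V = (KZ.of V - ∑ l, KZ.of (Vc l)) + ∑ l, KZ.of (Vc l) := by abel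
  rw [eV]
  exact add_mem hrel (sum_mem fun l _ => hVl l)

/-- **`CylKernelZeroLog ∧ CylKernelZeroCirclePos ⟹ CylKernelZeroMixed` (PROVED, Parts 12–13).** -/
theorem cylKernelZeroMixed_of_log_and_circle (hL : CylKernelZeroLog) (hC : CylKernelZeroCirclePos) :
    CylKernelZeroMixed :=
  cylKernelZeroMixed_of_signed (cylKernelZeroMixedSigned_of_log_and_circle hL hC)

/-- **Given the rung, the arctangent kind IS the pure positive circle kind:** `CylKernelZeroLog ⟹
(CylKernelZeroMixed ⟺ CylKernelZeroCirclePos)`. -/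
theorem cylKernelZeroMixed_iff_circlePos_of_log (hL : CylKernelZeroLog) :
    CylKernelZeroMixed ↔ CylKernelZeroCirclePos :=
  ⟨cylKernelZeroCirclePos_of_mixed, cylKernelZeroMixed_of_log_and_circle hL⟩

/-! ### Item-level corollaries after Parts 12–13: the residual of item 30572 is the PURE POSITIVE CIRCLE KIND. -/

/-- **Rung + trees ⟹ the non-positive arctangent kind** (closed modulo the two tree theorems). -/
theorem cylKernelZeroMixedNonpos_of_trees (hLS : LogStructure)
    (hBR : Summit.KontsevichZagierPeriods.LiouvilleUnfolding.LogPrimitiveNL.Negative.BoundaryRigidity) :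
    CylKernelZeroMixedNonpos :=
  cylKernelZeroMixedNonpos_of_log (cylKernelZeroLog_of_trees hLS hBR)

/-- **The ITEM decl of route C″** (stmt-30572) from the two tree theorems and the residual `CylKernelZeroMixedPos`
(Part 12 form), through the landed certified translation. -/
theorem regKernelPairDegOne_of_trees_and_pos (hLS : LogStructure)
    (hBR : Summit.KontsevichZagierPeriods.LiouvilleUnfolding.LogPrimitiveNL.Negative.BoundaryRigidity)
    (hPos : CylKernelZeroMixedPos) :
    Summit.KontsevichZagierPeriods.KontsevichZagierPeriods.Theses.RootDecompRelativeModAbsolute.RegKernelPairDegOne :=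
  regKernelPairDegOne_of_trees_and_mixed hLS hBR
    (cylKernelZeroMixed_of_nonpos_and_pos (cylKernelZeroMixedNonpos_of_trees hLS hBR) hPos)

/-- Conversely the Part-12 residual is NECESSARY: the item implies `CylKernelZeroMixedPos`. -/
theorem cylKernelZeroMixedPos_of_regKernelPairDegOne
    (h : Summit.KontsevichZagierPeriods.KontsevichZagierPeriods.Theses.RootDecompRelativeModAbsolute.RegKernelPairDegOne) :
    CylKernelZeroMixedPos :=
  cylKernelZeroMixedPos_of_mixed (cylKernelZeroMixed_of_regKernelPairDegOne h)

/-- **THE ITEM decl of route C″ (stmt-30572) ⟸ `LogStructure ∧ BoundaryRigidity ∧ CylKernelZeroCirclePos`** — the two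
TREE theorems and the ONE residual of g12, the pure positive circle kind on open cells (Parts 12–13), through the landed
certified translation `regKernelPairDegOne_iff_cylKernelZero`. -/
theorem regKernelPairDegOne_of_trees_and_circle (hLS : LogStructure)
    (hBR : Summit.KontsevichZagierPeriods.LiouvilleUnfolding.LogPrimitiveNL.Negative.BoundaryRigidity)
    (hC : CylKernelZeroCirclePos) :
    Summit.KontsevichZagierPeriods.KontsevichZagierPeriods.Theses.RootDecompRelativeModAbsolute.RegKernelPairDegOne :=
  regKernelPairDegOne_of_trees_and_mixed hLS hBR
    (cylKernelZeroMixed_of_log_and_circle (cylKernelZeroLog_of_trees hLS hBR) hC)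

/-- Conversely the residual is NECESSARY: the item implies `CylKernelZeroCirclePos`; so, GIVEN the two tree theorems,
`RegKernelPairDegOne ⟺ CylKernelZeroCirclePos`. -/
theorem cylKernelZeroCirclePos_of_regKernelPairDegOne
    (h : Summit.KontsevichZagierPeriods.KontsevichZagierPeriods.Theses.RootDecompRelativeModAbsolute.RegKernelPairDegOne) :
    CylKernelZeroCirclePos :=
  cylKernelZeroCirclePos_of_mixed (cylKernelZeroMixed_of_regKernelPairDegOne h)

/-- **Item 30572 ⟺ the pure positive circle kind, given the two tree theorems.** -/
theorem regKernelPairDegOne_iff_circlePos_of_trees (hLS : LogStructure)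
    (hBR : Summit.KontsevichZagierPeriods.LiouvilleUnfolding.LogPrimitiveNL.Negative.BoundaryRigidity) :
    Summit.KontsevichZagierPeriods.KontsevichZagierPeriods.Theses.RootDecompRelativeModAbsolute.RegKernelPairDegOne ↔
      CylKernelZeroCirclePos :=
  ⟨cylKernelZeroCirclePos_of_regKernelPairDegOne, regKernelPairDegOne_of_trees_and_circle hLS hBR⟩

end Summit.KontsevichZagierPeriods.RootDecompRelativeModAbsolute.Rung30571.RegularisedLogLayer.CylLog.Leaf

end

/-! # BLOCK G13 (appended at g12): g13 proposal statements, the Möbius rotation move (PROVED), fibre-map variant (PROVED), angle addition + reciprocal relation as KZ moves (PROVED, general base), Test §C (instance of the residual: hypotheses PROVED; conclusion PROVED) -/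
/-!
# G13Rung (decomp-kz lens-3, written at g12): typed g13 proposal + the MÖBIUS ROTATION move (PROVED) + fibred substitution with edge-vanishing Jacobian (PROVED) + ANGLE ADDITION as three KZ moves and the RECIPROCAL RELATION as five KZ moves (PROVED, general base) + the standing circle Test §C (all residual hypotheses PROVED, conclusion PROVED)

## The fibred MÖBIUS ROTATION is ONE Kontsevich–Zagier move

`[{a ≤ s ≤ b}, p/(1+s²)] − [{ψ_k a ≤ t ≤ ψ_k b}, p/(1+t²)] ∈ KZ.relations`, `ψ_k(s) = (s + k)/(1 − k s)` over a
`ℚ`-sa base on which `k` is differentiable and the band carries no pole (`1 − k s > 0`).  This is the rotation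
invariance `dψ/(1+ψ²) = ds/(1+s²)` of the arctangent kernel, i.e. ANGLE ADDITION
`arctan ψ_k(s) = arctan s + arctan k` as a KZ rule-2 move (`KZ.of_sub_of_mem_relations_of_fibreMap`): the circle
twin of the tree's log engine `KZ.of_sub_of_mem_relations_fibreSubst`, and the mechanism by which integer ANGLE
relations `Σ f_j arctan u_j ≡ m π` are to be realised in the calculus (g13 `CircleBoundaryRigidity`).
-/

/-!
# g13 PROPOSAL (decomp-kz lens-3, written at g12): the two TREE-SHAPED inputs for the pure positive circle kind
`CylKernelZeroCirclePos` — typed statements only (they ELABORATE; nothing is claimed proved here).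

* `CircleLogStructure` — the JOINT log/circle structure theorem of `ℚ`-semialgebraic identities
  `Σ hᵢ log Wᵢ + Σ pⱼ arctan uⱼ = g`: a.e. cover by open `ℚ`-sa cells on which `g ≡ 0`, the log coefficients are
  `ℚ`-sa combinations of EXACT integer relations `∏ Wᵢ^{f_r i} ≡ 1`, and the circle coefficients are `ℚ`-sa
  combinations of integer ANGLE relations `Σⱼ f'_s j · arctan uⱼ ≡ m_s π` (`m_s ∈ ℚ`) whose constants cancel,
  `Σ_s q'_s m_s ≡ 0`.  Mechanism: Ax–Schanuel over `ℂ` for the units `Wᵢ > 0` and the circle units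
  `wⱼ = (1 + i uⱼ)/(1 − i uⱼ)` — a joint multiplicative relation DECOUPLES into a positive one and a circle one by
  taking absolute values — then Baker at algebraic points (`log αᵣ`, `log ζ_s`, `iπ` are `ℚ`-independent).
* `CircleBoundaryRigidity` — the joint analogue of `…LogPrimitiveNL.Negative.BoundaryRigidity`: if
  `Σ hᵢ log Wᵢ + Σ pⱼ arctan uⱼ` (`Wᵢ ≥ 1`, `uⱼ ≥ 0`) is the integrand of an honest representation `g`, the unfolded
  log monomials `Uᵢ = [{1 ≤ s ≤ Wᵢ}, hᵢ/s]` and arctangent monomials `Aⱼ = [{0 ≤ t ≤ uⱼ}, pⱼ/(1+t²)]` satisfy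
  `Σ [Uᵢ] + Σ [Aⱼ] − [g] ∈ KZ.relations` (angle relations are realised by the fibred Möbius rotation
  `t ↦ (t + u)/(1 − t u)`, KZ rule 2, `KZ.of_sub_of_mem_relations_of_fibreMap`).
* The g13 NODE target would then be the circle twin of g12's `CellLocalWildCert` and the assembly
  `CircleLogStructure → CircleBoundaryRigidity → CellLocalCircleCert → CylKernelZeroCirclePos`
  (twin of `cylKernelZeroLog_of_localWildCert`), after the substitution `t = θ √κᵢ` (`κᵢ > 0` on the cell) which
  unfolds `cᵢ θ^M/(1+θ²κᵢ)` over `θ ∈ (0,1)` into `cᵢ κᵢ^{−(M+1)/2} t^M/(1+t²)` over `t ∈ (0, √κᵢ)`.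
-/

noncomputable section

open MeasureTheory Set
open Literature.NumberTheory.Transcendental Literature.ModelTheory.ExponentialFields

namespace Summit.KontsevichZagierPeriods.RootDecompRelativeModAbsolute.Rung30571.RegularisedLogLayer.CylLog.Leaf.G13

/-! ## The g13 PROPOSAL statements (typed; they elaborate; NOT claimed proved) -/

/-- **`CircleLogStructure` (g13 PROPOSAL)** — joint log/circle structure theorem. -/
def CircleLogStructure : Prop :=
  ∀ (n k l : ℕ) (U : Set (Fin n → ℝ)) (h W : Fin k → (Fin n → ℝ) → ℝ) (p u : Fin l → (Fin n → ℝ) → ℝ)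
    (g : (Fin n → ℝ) → ℝ),
    IsSemialgebraic ℚ U → (∀ i, IsSemialgebraicFunOn ℚ U (h i)) →
    (∀ i, IsSemialgebraicFunOn ℚ U (W i)) → (∀ i, ∀ x ∈ U, 0 < W i x) →
    (∀ j, IsSemialgebraicFunOn ℚ U (p j)) → (∀ j, IsSemialgebraicFunOn ℚ U (u j)) →
    IsSemialgebraicFunOn ℚ U g →
    (∀ x ∈ U, ∑ i, h i x * Real.log (W i x) + ∑ j, p j x * Real.arctan (u j x) = g x) →
    ∃ (N : ℕ) (C : Fin N → Set (Fin n → ℝ)),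
      (∀ c, IsSemialgebraic ℚ (C c) ∧ IsOpen (C c) ∧ C c ⊆ U) ∧
      Pairwise (Function.onFun Disjoint C) ∧ volume (U \ ⋃ c, C c) = 0 ∧
      ∀ c, (∀ x ∈ C c, g x = 0) ∧
        ∃ (R : ℕ) (f : Fin R → Fin k → ℤ) (q : Fin R → (Fin n → ℝ) → ℝ)
          (S : ℕ) (f' : Fin S → Fin l → ℤ) (m : Fin S → ℚ) (q' : Fin S → (Fin n → ℝ) → ℝ),
          (∀ r, IsSemialgebraicFunOn ℚ (C c) (q r)) ∧ (∀ r, ∀ x ∈ C c, ∏ i, W i x ^ (f r i) = 1) ∧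
          (∀ i, ∀ x ∈ C c, h i x = ∑ r, q r x * (f r i : ℝ)) ∧
          (∀ s, IsSemialgebraicFunOn ℚ (C c) (q' s)) ∧
          (∀ s, ∀ x ∈ C c, ∑ j, (f' s j : ℝ) * Real.arctan (u j x) = (m s : ℝ) * Real.pi) ∧
          (∀ x ∈ C c, ∑ s, q' s x * (m s : ℝ) = 0) ∧
          (∀ j, ∀ x ∈ C c, p j x = ∑ s, q' s x * (f' s j : ℝ))

/-- **`CircleBoundaryRigidity` (g13 PROPOSAL)** — the KZ calculus realises every `ℚ`-semialgebraic joint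
log/arctangent identity: unfolded log and arctangent monomials sum to the honest representation of the identity. -/
def CircleBoundaryRigidity : Prop :=
  ∀ (n k l : ℕ) (g : KZ.IntegralRep n) (h W : Fin k → (Fin n → ℝ) → ℝ) (p u : Fin l → (Fin n → ℝ) → ℝ)
    (U : Fin k → KZ.IntegralRep (n + 1)) (A : Fin l → KZ.IntegralRep (n + 1)),
    (∀ i, IsSemialgebraicFunOn ℚ g.domain (h i)) → (∀ i, IsSemialgebraicFunOn ℚ g.domain (W i)) →
    (∀ j, IsSemialgebraicFunOn ℚ g.domain (p j)) → (∀ j, IsSemialgebraicFunOn ℚ g.domain (u j)) →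
    (∀ i, ∀ x ∈ g.domain, 1 ≤ W i x) → (∀ j, ∀ x ∈ g.domain, 0 ≤ u j x) →
    (∀ i, (U i).domain = {z | (Fin.init z : Fin n → ℝ) ∈ g.domain ∧ 1 ≤ z (Fin.last n) ∧
      z (Fin.last n) ≤ W i (Fin.init z)}) →
    (∀ i, EqOn (U i).integrand (fun z => h i (Fin.init z) / z (Fin.last n)) (U i).domain) →
    (∀ j, (A j).domain = {z | (Fin.init z : Fin n → ℝ) ∈ g.domain ∧ 0 ≤ z (Fin.last n) ∧
      z (Fin.last n) ≤ u j (Fin.init z)}) →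
    (∀ j, EqOn (A j).integrand (fun z => p j (Fin.init z) / (1 + z (Fin.last n) ^ 2)) (A j).domain) →
    (∀ i, IntegrableOn (fun x => h i x * Real.log (W i x)) g.domain) →
    (∀ j, IntegrableOn (fun x => p j x * Real.arctan (u j x)) g.domain) →
    (∀ x ∈ g.domain, g.integrand x = ∑ i, h i x * Real.log (W i x) + ∑ j, p j x * Real.arctan (u j x)) →
    ∑ i, KZ.of (U i) + ∑ j, KZ.of (A j) - KZ.of g ∈ KZ.relations

/-- Sanity edge: the joint structure theorem specialises to the tree's `LogStructure` (no circle terms). -/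
theorem logStructure_of_circleLogStructure (h : CircleLogStructure) : LogStructure := by
  intro n k U hh W g hU hhsa hWsa hWpos hg hid
  obtain ⟨N, C, hC, hdisj, hnull, hcell⟩ := h n k 0 U hh W (fun j => Fin.elim0 j) (fun j => Fin.elim0 j) g hU hhsa
    hWsa hWpos (fun j => Fin.elim0 j) (fun j => Fin.elim0 j) hg (fun x hx => by simpa using hid x hx)
  refine ⟨N, C, hC, hdisj, hnull, fun c => ⟨(hcell c).1, ?_⟩⟩
  obtain ⟨R, f, q, S, f', m, q', hq, hrel, hh', -, -, -, -⟩ := (hcell c).2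
  exact ⟨R, f, q, hq, hrel, hh'⟩

/-- Sanity edge: the joint boundary rigidity specialises to the tree's `BoundaryRigidity` (no circle terms). -/
theorem boundaryRigidity_of_circleBoundaryRigidity (h : CircleBoundaryRigidity) :
    Summit.KontsevichZagierPeriods.LiouvilleUnfolding.LogPrimitiveNL.Negative.BoundaryRigidity := by
  intro n k g hh W U hhsa hWsa hW1 hUd hUi hint hg
  have := h n k 0 g hh W (fun j => Fin.elim0 j) (fun j => Fin.elim0 j) U (fun j => Fin.elim0 j) hhsa hWsa
    (fun j => Fin.elim0 j) (fun j => Fin.elim0 j) hW1 (fun j => Fin.elim0 j) hUd hUi (fun j => Fin.elim0 j)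
    (fun j => Fin.elim0 j) hint (fun j => Fin.elim0 j) (fun x hx => by simpa using hg x hx)
  simpa using this

/-- The rotation identity of the arctangent kernel: `(1+k²)/((1−ks)²(1+ψ²)) = 1/(1+s²)`, `ψ = (s+k)/(1−ks)`. -/
theorem mobius_kernel_identity {s k p : ℝ} (h : 1 - k * s ≠ 0) :
    p / (1 + ((s + k) / (1 - k * s)) ^ 2) * ((1 + k ^ 2) / (1 - k * s) ^ 2) = p / (1 + s ^ 2) := by
  have h1 : (1:ℝ) + s ^ 2 ≠ 0 := by positivity
  have h3 : (1 - k * s) ^ 2 ≠ 0 := pow_ne_zero 2 h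
  have hN' : 1 * (1 - k * s) ^ 2 + (s + k) ^ 2 = (1 + k ^ 2) * (1 + s ^ 2) := by ring
  have hN : 1 * (1 - k * s) ^ 2 + (s + k) ^ 2 ≠ 0 := by rw [hN']; positivity
  rw [div_pow, add_div' _ _ _ h3, div_div_eq_mul_div, div_mul_div_comm, div_eq_div_iff (mul_ne_zero hN h3) h1]
  rw [hN']
  ring

/-- **The fibred Möbius rotation move (PROVED from `KZ.of_sub_of_mem_relations_of_fibreMap`).**  Over a `ℚ`-sa base
`G`, with edges `a ≤ b` and a `ℚ`-sa rotation parameter `k`, differentiable along the band, such that the band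
`{a ≤ s ≤ b}` carries no pole of `ψ_k(s) = (s+k)/(1−ks)` (`1 − k s > 0`): the arctangent monomial over `[a, b]`
EQUALS, by one rule-2 move, the arctangent monomial over `[ψ_k a, ψ_k b]`. -/
theorem of_sub_of_mem_relations_mobius {m : ℕ} {G : Set (Fin m → ℝ)} {a b k p : (Fin m → ℝ) → ℝ}
    (r r' : KZ.IntegralRep (m + 1)) (hr : r.domain = KZlog.band G a b)
    (hr' : r'.domain = KZlog.band G (fun y => (a y + k y) / (1 - k y * a y)) (fun y => (b y + k y) / (1 - k y * b y)))
    (hab : ∀ y ∈ G, a y ≤ b y) (hk : IsSemialgebraicFunOn ℚ G k)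
    (hkd : ∀ z ∈ r.domain, DifferentiableAt ℝ (fun w : Fin (m + 1) → ℝ => k (Fin.init w)) z)
    (hden : ∀ z ∈ r.domain, 0 < 1 - k (Fin.init z) * z (Fin.last m))
    (hri : r.integrand = fun z => p (Fin.init z) / (1 + z (Fin.last m) ^ 2))
    (hr'i : r'.integrand = fun z => p (Fin.init z) / (1 + z (Fin.last m) ^ 2)) :
    KZ.of r - KZ.of r' ∈ KZ.relations := by
  have hband_sa : IsSemialgebraic ℚ r.domain := r.isSemialgebraic_domain
  have hsub : r.domain ⊆ {z | (Fin.init z : Fin m → ℝ) ∈ G} := fun z hz => by rw [hr] at hz; exact hz.1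
  have hkI : IsSemialgebraicFunOn ℚ r.domain (fun z => k (Fin.init z)) := hk.comp_init.mono hsub hband_sa
  have hsI : IsSemialgebraicFunOn ℚ r.domain (fun z => z (Fin.last m)) :=
    Literature.NumberTheory.Transcendental.isSemialgebraicFunOn_apply hband_sa (Fin.last m)
  have hnumI : IsSemialgebraicFunOn ℚ r.domain (fun z => z (Fin.last m) + k (Fin.init z)) :=
    IsSemialgebraicFunOn.add_holds hsI hkI
  have hdenI : IsSemialgebraicFunOn ℚ r.domain (fun z => 1 - k (Fin.init z) * z (Fin.last m)) :=
    (IsSemialgebraicFunOn.sub_holds (isSemialgebraicFunOn_ratCast hband_sa 1)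
      (IsSemialgebraicFunOn.mul_holds hkI hsI)).congr fun _ _ => by simp
  set ψ : (Fin (m + 1) → ℝ) → ℝ := fun z => (z (Fin.last m) + k (Fin.init z)) / (1 - k (Fin.init z) * z (Fin.last m))
    with hψdef
  set ψs : (Fin (m + 1) → ℝ) → ℝ := fun z => (1 + k (Fin.init z) ^ 2) / (1 - k (Fin.init z) * z (Fin.last m)) ^ 2
    with hψsdef
  have hψ : IsSemialgebraicFunOn ℚ r.domain ψ :=
    IsSemialgebraicFunOn.div hnumI hdenI fun z hz => (hden z hz).ne'
  refine KZ.of_sub_of_mem_relations_of_fibreMap ψ ψs r r' hr hr' hab hψ ?_ ?_ ?_ ?_ ?_ ?_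
  · -- differentiability of `ψ` in all variables
    intro z hz
    have hlast : DifferentiableAt ℝ (fun w : Fin (m + 1) → ℝ => w (Fin.last m)) z := differentiableAt_apply _ _
    have hnum : DifferentiableAt ℝ (fun w : Fin (m + 1) → ℝ => w (Fin.last m) + k (Fin.init w)) z :=
      hlast.add (hkd z hz)
    have hdd : DifferentiableAt ℝ (fun w : Fin (m + 1) → ℝ => 1 - k (Fin.init w) * w (Fin.last m)) z :=
      (differentiableAt_const (1:ℝ)).sub ((hkd z hz).mul hlast)
    have hd : DifferentiableAt ℝ (fun w : Fin (m + 1) → ℝ =>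
        (w (Fin.last m) + k (Fin.init w)) * (1 - k (Fin.init w) * w (Fin.last m))⁻¹) z :=
      hnum.mul (hdd.inv (hden z hz).ne')
    simpa only [hψdef, div_eq_mul_inv] using hd
  · -- the fibre derivative
    intro z hz
    have hne : 1 - k (Fin.init z) * z (Fin.last m) ≠ 0 := (hden z hz).ne'
    have h1 : HasDerivAt (fun t : ℝ => t + k (Fin.init z)) 1 (z (Fin.last m)) := (hasDerivAt_id _).add_const _
    have h2 : HasDerivAt (fun t : ℝ => 1 - k (Fin.init z) * t) (-k (Fin.init z)) (z (Fin.last m)) := by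
      simpa using ((hasDerivAt_id (z (Fin.last m))).const_mul (k (Fin.init z))).const_sub 1
    have h3 := h1.div h2 hne
    have e : (1 * (1 - k (Fin.init z) * z (Fin.last m)) - (z (Fin.last m) + k (Fin.init z)) * -k (Fin.init z)) /
        (1 - k (Fin.init z) * z (Fin.last m)) ^ 2 = ψs z := by
      simp only [hψsdef]
      congr 1
      ring
    rw [e] at h3
    refine h3.congr_of_eventuallyEq (Filter.Eventually.of_forall fun t => ?_)
    simp only [hψdef, Fin.init_snoc, Fin.snoc_last, Pi.div_apply]
  · -- positivity of the fibre derivative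
    intro z hz
    simp only [hψsdef]
    have := hden z hz
    positivity
  · intro y _; simp only [hψdef, Fin.init_snoc, Fin.snoc_last]
  · intro y _; simp only [hψdef, Fin.init_snoc, Fin.snoc_last]
  · -- the integrand transforms by the rotation identity
    intro z hz
    rw [hri, hr'i]
    simp only [hψdef, hψsdef, Fin.init_snoc, Fin.snoc_last]
    exact (mobius_kernel_identity (hden z hz).ne').symm

/-! ## FIBRED SUBSTITUTION with a Jacobian vanishing at the band edges (g13 engine piece) -/

/-
Fibred substitution with a Jacobian that may vanish at the band edges (g13 engine piece, decomp-kz lens-3 g12)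

`of_sub_of_mem_relations_of_fibreMap'` — the Literature move `KZ.of_sub_of_mem_relations_of_fibreMap` with the
positivity `0 < ψs` required only at INTERIOR fibre points `a(y) < s < b(y)` and `0 ≤ ψs` on the closed band
(e.g. `u = θ²` on `[0,1]`, whose Jacobian `2θ` vanishes at `θ = 0`: the substitution turning odd-`M` circle terms
`θ^{2j+1}/(1+θ²κ)` into log-kind terms `u^j/(2(1+uκ))`).  Proof = the Literature proof verbatim
(strict monotonicity needs the derivative positive on the interior only; `|det Φ'| = ψs` needs `ψs ≥ 0` only).
-/

section FibreMapVariant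
open MvPolynomial

/-- `w = snoc (init w) 0 + w_last • e_last` (copy of the private Literature helper). -/
private theorem eq_snoc_init_zero_add' (m : ℕ) (w : Fin (m + 1) → ℝ) :
    w = Fin.snoc (Fin.init w) (0 : ℝ) + w (Fin.last m) • (Pi.single (Fin.last m) (1 : ℝ) : Fin (m + 1) → ℝ) := by
  ext i
  refine Fin.lastCases ?_ (fun j => ?_) i
  · simp
  · simp [(Fin.castSucc_lt_last j).ne, Fin.init]

end FibreMapVariant
end Summit.KontsevichZagierPeriods.RootDecompRelativeModAbsolute.Rung30571.RegularisedLogLayer.CylLog.Leaf.G13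
end
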